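import Summits.CriticalPhenomena.Ising3DConformalLimit.Theses.LogPolarProxy
import Summits.CriticalPhenomena.Ising3DConformalLimit.Theorems.MoebiusLimitExists.Negative.MeshContinuity

/-!
# Crux `LogPolarProxy.ExistsContinuousLimit` (stmt-CriticalPhenomena-4582) — birth skeleton `Lines/birth.lean`

LEAD STATUS (prover-line-stmt-CriticalPhenomena-4582-0, 2026-08-17, cycle 1): line `birth` picked (the only
served line). S2 `stub_limitContinuity` is CLOSED — it needs no Ising input at all: mesh continuity of every
full-filter pointwise limit of `criticalCorr 3` (tree theorem `LimitMeshContinuity.continuousOn_limit`,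
`Theorems/MoebiusLimitExists/Negative/MeshContinuity.lean`); landed verbatim as
`LogPolarProxyExistsContinuousLimit.stub_limitContinuity` together with
`existsContinuousLimit_iff_existsScaleCovariantLimit : ExistsContinuousLimit ↔ HyperoctahedralRP.ExistsScaleCovariantLimit`
(file `Theorems/LogPolarProxyExistsContinuousLimitLimitContinuity.lean`). The composition below is RESHAPED to
the single open stub S1 `stub_existsScaleCovariantLimit` = stmt-CriticalPhenomena-1981 verbatim (the open
existence problem); the crux is now literally equivalent to stmt-1981. Registrar's text follows.

Skeleton registrar `planner-skel-stmt-CriticalPhenomena-4582-0`, 2026-08-17 (route re-audit bin REPAIRABLE;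
route `route-CriticalPhenomena-LogPolarProxy`, primary; the crux is SHARED verbatim with
`route-CriticalPhenomena-ReflectionTwin`; sub-problem `Ising3DConformalLimit`).

The crux (rank 3): there are a renormalisation `ρ > 0` on `(0,1]`, a dimension `Δ > 0` and a family
`S : CorrFamily 3` with `HasPointwiseScalingLimit (criticalCorr 3) ρ S`, `S = 0` off `NonCoincident`,
`S n` CONTINUOUS on `NonCoincident 3 n` for every `n`, `IsNondegenerateTwoPoint S`,
`IsTranslationInvariant S`, `IsScaleCovariant Δ S`. In words: the full `δ → 0⁺` scaling limit of the critical
nearest-neighbour Ising spin correlators on `ℤ³` exists with ONE power law `Δ`, is normalised, continuous,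
non-degenerate, translation invariant and scale covariant (no rotation, no inversion clause — those are the
OUTPUT of the route).

## The line (the route's own two-layer plan, `ExistsContinuousLimit ⇐ ExistsScaleCovariantLimit → LimitContinuity`)

* `stub_existsScaleCovariantLimit` (E_sc; XL, OPEN — Duminil-Copin ICM 2022 §8.4 "widely open"): the crux
  WITHOUT its continuity clause. Its signature is, verbatim, the shared item
  `HyperoctahedralRP.ExistsScaleCovariantLimit` (stmt-CriticalPhenomena-1981, wanted by several routes), so a
  proof of stmt-1981 anywhere in the tree discharges this stub by `Iff.rfl` transport. Why it might fail: the
  IR/MMS window `c|x|⁻² ≤ ⟨σ₀σ_x⟩_{β_c} ≤ C|x|⁻¹` gives only subsequential limits and `Δ ∈ [1/2, 1]`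
  (`Literature.Probability.LatticeModels.scalingDimension_mem_Icc_holds`); GKS/RP axiomatics admit
  log-periodic renormalisations with no single `Δ`.
* `stub_limitContinuity` (THE NEW NODE of this crux relative to stmt-1981; L): **a priori regularity of the
  critical Ising scaling limit** — every normalised, non-degenerate, translation-invariant, `Δ`-scale-covariant
  (`Δ > 0`) pointwise scaling limit `S` of `criticalCorr 3` along a positive renormalisation is continuous on
  `NonCoincident 3 n` for every `n`. NOT automatic: `HasPointwiseScalingLimit` is locally uniform convergence
  of STEP functions, and e.g. the translation-invariant, scale-covariant, non-degenerate family with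
  `S₂(x,y) = ‖y−x‖^{-2Δ}(1 + 1_{(y−x)₁ ≥ 0})` is its own scaling limit and is discontinuous — so the
  Ising-specific input is load-bearing. Intended attack: Messager–Miracle-Solé monotonicity of
  `⟨σ_A σ_x⟩` under moving an extremal point `x` away from `A` across coordinate AND diagonal lattice planes
  passes to the pointwise limit `S`; with translation invariance and `Δ`-scale covariance every
  non-coincident configuration is pinched between similar copies of itself reached by monotone moves
  (`(1+η)^{-nΔ} S z ≤ S z' ≤ (1−η)^{-nΔ} S z`), which is continuity (for `n = 2` this is the classical
  squeeze `g(x) ≥ g(x+te₁) ≥ g((1+t/x₁)x)`, with the diagonal planes handling coordinate-plane points).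
  Why it might fail: for `n ≥ 3` an interior point of a configuration is separated from the others by no
  lattice symmetry plane, so the pinching needs a combinatorial-geometry lemma (move the OTHER, extremal,
  points and close up by a similarity) that is not in print; only axis/diagonal MMS is available on `ℤ³`.
* `ExistsContinuousLimit_of : S1 → S2 → ExistsContinuousLimit` — kernel-checked, sorry-free: destructure S1,
  feed its data and clauses to S2, reassemble the eight conjuncts. Its hypotheses are the stub statements BY
  NAME (`__Registered.stub_*`, `abbrev`s repeating the registered signatures verbatim — the form
  `#h21_check_skeleton` admits, as in the sibling skeleton `Cruxes/BallSpecifiedFieldLimit/Lines/birth.lean`),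
  and the closing `example` feeds it the registered stubs.

Disproof used: none — `Cruxes/ExistsContinuousLimit/` had no `Disproof.lean`, no `Lines/`, no `Negative/`
lemma at registration (2026-08-17, `ledger crux ls stmt-CriticalPhenomena-4582`: "(no workfiles yet)").
Negatives index: the summit's refuted statements (`ScaleCovarianceNotMoebius`-type bare-`CorrFamily`
covariance claims, the coincident-locus refutations of 0632/0637, the SAW item 0772) are not instances of
either stub: S1 is an existence statement about `criticalCorr 3`, S2 quantifies over limits OF `criticalCorr 3`
and carries normalisation + non-degeneracy.

BC3 (registrar): `lean check` rc 0, sorries = 2 = stubs, zero elsewhere; probes `stub → ExistsContinuousLimit`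
and `stub → Ising3DConformalLimit` by `first | exact? | simpa | aesop` FAIL for both stubs (files
`bc/probe_*.lean` in the registrar's folder; verdicts quoted in NOTES.md and on the item evidence note).
-/

noncomputable section

namespace Summit.CriticalPhenomena.Ising3DConformalLimit.Cruxes.ExistsContinuousLimit.Birth

open Filter

/-- Registered stub `stub_existsScaleCovariantLimit` — **S1 · E_sc: the critical 3-D Ising spin correlators
have a full pointwise scaling limit `(ρ, Δ, S)` along `δ → 0⁺`, normalised off `NonCoincident`, with
non-degenerate two-point function, translation invariant and `Δ`-scale covariant (`Δ > 0`).** OPEN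
(Duminil-Copin ICM 2022 §8.4). Verbatim the shared item `HyperoctahedralRP.ExistsScaleCovariantLimit`
(stmt-CriticalPhenomena-1981); strictly weaker than the crux (no continuity clause). -/
theorem stub_existsScaleCovariantLimit :
    ∃ (ρ : ℝ → ℝ) (Δ : ℝ) (S : Literature.Probability.LatticeModels.CorrFamily 3),
      (∀ δ ∈ Set.Ioc (0:ℝ) 1, 0 < ρ δ) ∧ 0 < Δ ∧
      Literature.Probability.LatticeModels.HasPointwiseScalingLimit
        (Literature.Probability.LatticeModels.criticalCorr 3) ρ S ∧
      (∀ n z, z ∉ Literature.Probability.LatticeModels.NonCoincident 3 n → S n z = 0) ∧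
      Literature.Probability.LatticeModels.IsNondegenerateTwoPoint S ∧
      Literature.Probability.LatticeModels.IsTranslationInvariant S ∧
      Literature.Probability.LatticeModels.IsScaleCovariant Δ S := by
  sorry

/-- Registered stub `stub_limitContinuity` — **S2 · a priori regularity of the critical Ising scaling limit:
every normalised, non-degenerate, translation-invariant, `Δ`-scale-covariant (`Δ > 0`) pointwise scaling
limit `S` of `criticalCorr 3` along a renormalisation `ρ > 0` on `(0,1]` is continuous on the non-coincident
configurations, `ContinuousOn (S n) (NonCoincident 3 n)` for every `n`.** The Ising input
(Messager–Miracle-Solé monotonicity across coordinate and diagonal planes, inherited by the limit) is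
load-bearing: a general scale-covariant translation-invariant non-degenerate family need not be continuous. -/
theorem stub_limitContinuity :
    ∀ (ρ : ℝ → ℝ) (Δ : ℝ) (S : Literature.Probability.LatticeModels.CorrFamily 3),
      (∀ δ ∈ Set.Ioc (0:ℝ) 1, 0 < ρ δ) → 0 < Δ →
      Literature.Probability.LatticeModels.HasPointwiseScalingLimit
        (Literature.Probability.LatticeModels.criticalCorr 3) ρ S →
      (∀ n z, z ∉ Literature.Probability.LatticeModels.NonCoincident 3 n → S n z = 0) →
      Literature.Probability.LatticeModels.IsNondegenerateTwoPoint S →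
      Literature.Probability.LatticeModels.IsTranslationInvariant S →
      Literature.Probability.LatticeModels.IsScaleCovariant Δ S →
      ∀ n, ContinuousOn (S n) (Literature.Probability.LatticeModels.NonCoincident 3 n) := by
  -- CLOSED (lead, 2026-08-17): mesh continuity — no Ising input; landed verbatim as
  -- `LogPolarProxyExistsContinuousLimit.stub_limitContinuity` (Theorems/…LimitContinuity.lean, p146967)
  intro ρ _Δ S _hρ _hΔ hlim _hzero _hnd _htr _hsc n
  exact Summit.CriticalPhenomena.Ising3DConformalLimit.LimitMeshContinuity.continuousOn_limit hlim n

/-! ### The open stub statement BY NAME — the hypothesis of `ExistsContinuousLimit_of`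

RESHAPE (lead, 2026-08-17, cycle 1): S2 `stub_limitContinuity` is now PROVED above (mesh continuity), so the
composition takes ONLY the open stub S1 as hypothesis and calls the proved S2 inside. The native skeleton audit
(`#h21_check_skeleton`, run by `ledger skeleton check`) admits a hypothesis of the composing theorem only if its
head constant is a registered obligation or is NAMED like a declared (sorried) stub; so the registered stub
`stub_existsScaleCovariantLimit : <signature> := by sorry` above is mirrored by the alias
`abbrev __Registered.stub_existsScaleCovariantLimit : Prop := <the same signature, verbatim>` and
`ExistsContinuousLimit_of` is stated over that alias (device of the sibling skeleton
`Cruxes/BallSpecifiedFieldLimit/Lines/birth.lean`). The alias is an `abbrev`, definitionally its statement, and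
the `example` after the composition instantiates it with the registered stub (kernel-checked). -/
namespace __Registered

/-- Alias of the statement of the registered stub `stub_existsScaleCovariantLimit` (S1), keyed by its name. -/
abbrev stub_existsScaleCovariantLimit : Prop :=
    ∃ (ρ : ℝ → ℝ) (Δ : ℝ) (S : Literature.Probability.LatticeModels.CorrFamily 3),
      (∀ δ ∈ Set.Ioc (0:ℝ) 1, 0 < ρ δ) ∧ 0 < Δ ∧
      Literature.Probability.LatticeModels.HasPointwiseScalingLimit
        (Literature.Probability.LatticeModels.criticalCorr 3) ρ S ∧
      (∀ n z, z ∉ Literature.Probability.LatticeModels.NonCoincident 3 n → S n z = 0) ∧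
      Literature.Probability.LatticeModels.IsNondegenerateTwoPoint S ∧
      Literature.Probability.LatticeModels.IsTranslationInvariant S ∧
      Literature.Probability.LatticeModels.IsScaleCovariant Δ S

end __Registered

/-- **Composition `ExistsContinuousLimit_of : S1 → ExistsContinuousLimit`** (kernel-checked, no `sorry`;
hypothesis = the one open stub statement by name, `__Registered.stub_existsScaleCovariantLimit`, an `abbrev` of
the registered signature): destructure the scale-covariant limit `(ρ, Δ, S)` of S1; the PROVED stub
`stub_limitContinuity` (S2) applied to its data and clauses gives `ContinuousOn (S n) (NonCoincident 3 n)` for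
every `n`; reassemble the eight conjuncts of the crux, concluded BY NAME as the route decl
`LogPolarProxy.ExistsContinuousLimit`. In particular the crux is EQUIVALENT to S1 = stmt-CriticalPhenomena-1981
(the converse forgets continuity; both directions landed in
`Theorems/LogPolarProxyExistsContinuousLimitLimitContinuity.lean`). -/
theorem ExistsContinuousLimit_of :
    __Registered.stub_existsScaleCovariantLimit →
    Summit.CriticalPhenomena.Ising3DConformalLimit.Theses.LogPolarProxy.ExistsContinuousLimit := by
  intro h₁
  dsimp only [__Registered.stub_existsScaleCovariantLimit] at h₁
  obtain ⟨ρ, Δ, S, hρ, hΔ, hlim, hzero, hnd, htr, hsc⟩ := h₁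
  -- S2 (proved): a priori continuity of this limit on the non-coincident configurations
  have hcont : ∀ n, ContinuousOn (S n) (Literature.Probability.LatticeModels.NonCoincident 3 n) :=
    stub_limitContinuity ρ Δ S hρ hΔ hlim hzero hnd htr hsc
  exact ⟨ρ, Δ, S, hρ, hΔ, hlim, hzero, hcont, hnd, htr, hsc⟩

/-- **The registered open stub discharges the hypothesis of `ExistsContinuousLimit_of` verbatim**
(kernel-checked `example`, deliberately NOT a named declaration: it depends on S1's `sorry` until stmt-1981
lands — then `ExistsContinuousLimit_of stub_existsScaleCovariantLimit` IS the proof of the crux). -/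
example : Summit.CriticalPhenomena.Ising3DConformalLimit.Theses.LogPolarProxy.ExistsContinuousLimit :=
  ExistsContinuousLimit_of stub_existsScaleCovariantLimit

end Summit.CriticalPhenomena.Ising3DConformalLimit.Cruxes.ExistsContinuousLimit.Birth

end
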